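import Literature.AnabelianGeometry.EtaleTheta.LogDivisorModelTateTowerArithmeticNumberField

/-!
# [EtTh] Def. 3.1 / Def. 3.3: the Tate tower datum of a prime of `𝓞 L` that is UNIQUE over its contraction to `𝓞 K`

S. Mochizuki, *The étale theta function …*, Publ. RIMS **45** (2009) [MochizukiEtTh2009], §3 Def. 3.1 (PRIMS PDF
p.70), Def. 3.3 (ii)–(iii) (p.73) [cite: MochizukiEtTh2009, Def 3.3 p.73].  abc-iut cell, seat abc-iut-w5-d223 gen
6; in-lineage sequel #5 to `LogDivisorModelTateTowerArithmeticNumberField.lean` (p473352/p473822), whose constructor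
`TateTowerArith.Datum.ofFixedPrime` takes the hypothesis «every `σ ∈ Aut(L/K)` maps `P` into itself».  THIS FILE
DISCHARGES that hypothesis from an arithmetic one of OUR OWN choosing — «`P` is the ONLY height-one prime of `𝓞 L`
above its contraction `P ∩ 𝓞 K`» (for number fields: an inert or totally ramified prime; this gloss is ours, not
print's).  ATTRIBUTION NOTE (wording fixed per referee finding A33-n1-rec2, D-ref-3, doc-only; v1/v2 called this «the
arithmetic [hypothesis] print uses», which was a pseudo-attribution): print states NO such hypothesis — its constant
field is a finite extension of `ℚ_p` (printed p.297, «let K be a finite extension of Qp»), whose ring of integers is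
local, so uniqueness of the prime over its contraction is automatic there; the number-field setting of this lineage,
where uniqueness is a genuine condition, is OUR extension of print (cf. the same note in
`LogDivisorModelTateTowerArithmeticNumberField.lean` v3).  Contents:
* **`TateTowerArith.restrictIntegers_mem_of_unique_over`** — if `P ⊆ 𝓞 L` is the only height-one prime with its
  contraction `P ∩ 𝓞 K`, then every `σ ∈ Aut(L/K)` maps `P` into itself (`σ(P)` is a height-one prime with the same
  contraction, `Ideal.map_comap_of_equiv` + `σ` fixes `𝓞 K` pointwise);
* **`TateTowerArith.Datum.ofUniquePrimeOver`** — the parameter record `Datum K L` from a prime unique over its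
  contraction and a `K`-rational uniformizer; `constGaloisLaw_ofUniquePrimeOver`. Class (b) constructor; no new
  Prop-valued fact, no `instance`, no notation.  HONEST FRAMING: consistency/NV machinery for the typed [EtTh] §3
  interfaces; nothing of [EtTh] asserted; nothing here bears on [IUTchIII] Cor. 3.12; no side taken; typed ≠ proved.
-/

noncomputable section

namespace Literature.AnabelianGeometry.EtaleTheta

open IsDedekindDomain

namespace LogDivisorModel.TateTowerArith

open NumberField

variable {K L : Type} [Field K] [NumberField K] [Field L] [NumberField L] [Algebra K L]

omit [NumberField K] [NumberField L] in
/-- `restrictIntegers σ` fixes `𝓞 K ⊆ 𝓞 L` pointwise. [cite: MochizukiEtTh2009, Def 3.3 p.73] -/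
theorem restrictIntegers_algebraMap (σ : L ≃ₐ[K] L) (x : 𝓞 K) :
    restrictIntegers σ (algebraMap (𝓞 K) (𝓞 L) x) = algebraMap (𝓞 K) (𝓞 L) x := by
  apply RingOfIntegers.ext
  rw [coe_restrictIntegers]
  exact σ.commutes (x : K)

omit [NumberField K] in
/-- The image `σ(P)` of a height-one prime of `𝓞 L` under `σ ∈ Aut(L/K)`, as a height-one prime.
[cite: MochizukiEtTh2009, Def 3.3 p.73] -/
def mapPrime (σ : L ≃ₐ[K] L) (P : HeightOneSpectrum (𝓞 L)) : HeightOneSpectrum (𝓞 L) where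
  asIdeal := Ideal.map (restrictIntegers σ) P.asIdeal
  isPrime := Ideal.map_isPrime_of_equiv (restrictIntegers σ)
  ne_bot := by
    rw [Ne, Ideal.map_eq_bot_iff_of_injective (restrictIntegers σ).injective]
    exact P.ne_bot

omit [NumberField K] [NumberField L] in
/-- `σ(P)` has the same contraction to `𝓞 K` as `P`. [cite: MochizukiEtTh2009, Def 3.3 p.73] -/
theorem comap_mapPrime (σ : L ≃ₐ[K] L) (P : HeightOneSpectrum (𝓞 L)) :
    (mapPrime σ P).asIdeal.comap (algebraMap (𝓞 K) (𝓞 L)) = P.asIdeal.comap (algebraMap (𝓞 K) (𝓞 L)) := by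
  ext x
  change algebraMap (𝓞 K) (𝓞 L) x ∈ Ideal.map (restrictIntegers σ) P.asIdeal ↔ algebraMap (𝓞 K) (𝓞 L) x ∈ P.asIdeal
  rw [show Ideal.map (restrictIntegers σ) P.asIdeal = Ideal.map ((restrictIntegers σ : 𝓞 L ≃+* 𝓞 L) : 𝓞 L →+* 𝓞 L)
      P.asIdeal from rfl, Ideal.map_comap_of_equiv, Ideal.mem_comap]
  have h : (restrictIntegers σ).symm (algebraMap (𝓞 K) (𝓞 L) x) = algebraMap (𝓞 K) (𝓞 L) x := by
    rw [RingEquiv.symm_apply_eq, restrictIntegers_algebraMap]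
  change (restrictIntegers σ).symm (algebraMap (𝓞 K) (𝓞 L) x) ∈ P.asIdeal ↔ _
  rw [h]

omit [NumberField K] [NumberField L] in
/-- **A prime unique over its contraction is `Aut(L/K)`-fixed**: if `P` is the only height-one prime of `𝓞 L`
contracting to `P ∩ 𝓞 K` (e.g. an inert or totally ramified prime — our number-field gloss, see the header's
attribution note), every `σ ∈ Aut(L/K)` maps `P` into itself. [cite: MochizukiEtTh2009, Def 3.3 p.73] -/
theorem restrictIntegers_mem_of_unique_over (P : HeightOneSpectrum (𝓞 L))
    (huniq : ∀ Q : HeightOneSpectrum (𝓞 L),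
      Q.asIdeal.comap (algebraMap (𝓞 K) (𝓞 L)) = P.asIdeal.comap (algebraMap (𝓞 K) (𝓞 L)) → Q = P)
    (σ : L ≃ₐ[K] L) (x : 𝓞 L) (hx : x ∈ P.asIdeal) : restrictIntegers σ x ∈ P.asIdeal := by
  have hQ : mapPrime σ P = P := huniq (mapPrime σ P) (comap_mapPrime σ P)
  have hmem : restrictIntegers σ x ∈ (mapPrime σ P).asIdeal := Ideal.mem_map_of_mem _ hx
  rwa [hQ] at hmem

/-- **The Tate tower datum of a prime unique over its contraction** (class (b) constructor): number fields `K ⊆ L`, a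
height-one prime `P ⊆ 𝓞 L` that is the ONLY one above `P ∩ 𝓞 K`, and a `K`-rational `q` with `v_P(q) = exp(−1)` (so
`P` is unramified with `q` a uniformizer, hence inert over `K` — our gloss; print's constant field is an MLF, see the
header's attribution note). [cite: MochizukiEtTh2009, Def 3.1 p.70] -/
def Datum.ofUniquePrimeOver (P : HeightOneSpectrum (𝓞 L))
    (huniq : ∀ Q : HeightOneSpectrum (𝓞 L),
      Q.asIdeal.comap (algebraMap (𝓞 K) (𝓞 L)) = P.asIdeal.comap (algebraMap (𝓞 K) (𝓞 L)) → Q = P)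
    (q : K) (hq : P.valuation L (algebraMap K L q) = WithZero.exp (-1)) : Datum K L :=
  Datum.ofFixedPrime P (restrictIntegers_mem_of_unique_over P huniq) q hq

/-- Its Galois-correspondence law ([EtTh] Thm 3.7 (iii) binder) with `Aut(L/K)` the full automorphism group.
[cite: MochizukiEtTh2009, Thm 3.7 (iii) p.79] -/
theorem constGaloisLaw_ofUniquePrimeOver (P : HeightOneSpectrum (𝓞 L))
    (huniq : ∀ Q : HeightOneSpectrum (𝓞 L),
      Q.asIdeal.comap (algebraMap (𝓞 K) (𝓞 L)) = P.asIdeal.comap (algebraMap (𝓞 K) (𝓞 L)) → Q = P)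
    (q : K) (hq : P.valuation L (algebraMap K L q) = WithZero.exp (-1)) :
    (Datum.ofUniquePrimeOver P huniq q hq).action.ConstGaloisLaw :=
  (Datum.ofUniquePrimeOver P huniq q hq).constGaloisLaw

/-! ### Non-vacuity: `K = L = ℚ`, where every prime is trivially unique over its contraction -/

/-- **The constructor is inhabited**: over `K = L = ℚ` the contraction map is the identity, so every height-one prime
is unique over its contraction; with `P = (p)`, `q = p` this is the lineage's `ℚ`-datum again.
[cite: MochizukiEtTh2009, Def 3.1 p.70] -/
def Datum.ofUniquePrimeOverRat (p : ℕ) [Fact p.Prime] : Datum ℚ ℚ :=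
  Datum.ofUniquePrimeOver (RatIntegers.primeSpec p)
    (fun Q hQ => by
      refine HeightOneSpectrum.ext ?_
      have hid : ∀ I : Ideal (𝓞 ℚ), I.comap (algebraMap (𝓞 ℚ) (𝓞 ℚ)) = I := fun I => by
        ext x
        rw [Ideal.mem_comap]
        have hx : algebraMap (𝓞 ℚ) (𝓞 ℚ) x = x :=
          RingOfIntegers.ext (by change algebraMap ℚ ℚ (x : ℚ) = (x : ℚ); exact Algebra.algebraMap_self_apply _)
        rw [hx]
      exact (hid _).symm.trans (hQ.trans (hid _)))
    (p : ℚ) (by rw [Algebra.algebraMap_self_apply]; exact RatIntegers.valuation_primeSpec_self p)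

end LogDivisorModel.TateTowerArith

end Literature.AnabelianGeometry.EtaleTheta

end
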